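import Literature.Probability.LatticeModels.MeshDomainBigComponents
import Summits.CriticalPhenomena.CardyFormulaZ2.Theorems.CardyComplexConeSLESixFamiliesGiveCardyDefs

/-!
# drefute gen-6 — helper for STUB A `stub_upperFence` (crux `SLESixFamiliesGiveCardy`,
stmt-CriticalPhenomena-9654, line `collar-touch-sandwich`): EVENTUAL MONOTONICITY OF THE
DISCRETE DOMAIN, `Ω ⊆ Ω' ⇒ Ω_δ ⊆ Ω'_δ` and `discreteDomainGraph Ω δ ≤ discreteDomainGraph Ω' δ`
for all small `δ`, for Jordan domains.

Why the lead needs it (fence argument of STUB A, step "a crossed edge of the open `Ω_δ`-crossing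
`π` is bc-closed"): `π` is a path of `discreteDomainGraph R.carrier δ`, while `bcBondConfig`
of the collared data `Λ δ` (domain `D.carrier ⊇ R.carrier`) speaks about
`discreteDomainGraph D.carrier δ`; the inclusion of the LARGEST-COMPONENT discretisations is not
monotone mesh by mesh (a stray component of `Ω'` may swallow `Ω_δ` at a given mesh) but holds
eventually, by the bulk theorem `JordanDomain.exists_forall_mem_meshDomain_and_reachable`
(Osgood boundaries included — no area hypothesis).  Positive helper, NOT a refutation; attached as
evidence / crux workfile for the lead.  `lean check`: rc 0, 0 sorries, 0 warnings.
-/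

noncomputable section

open Set Filter Topology Metric
open Literature.Probability Literature.Probability.RandomPlanarGeometry
  Literature.Probability.LatticeModels

namespace Summit.CriticalPhenomena.CardyFormulaZ2.Cruxes.SLESixFamiliesGiveCardy.CollarTouchSandwich

namespace DrefuteG6

/-- Mesh vertices are monotone in the domain. [folklore] -/
theorem meshVertices_mono {Ω Ω' : Set ℂ} (h : Ω ⊆ Ω') (δ : ℝ) :
    meshVertices Ω δ ⊆ meshVertices Ω' δ := fun _ hx => h hx

/-- The mesh graph is monotone in the domain. [folklore] -/
theorem meshGraph_mono {Ω Ω' : Set ℂ} (h : Ω ⊆ Ω') (δ : ℝ) : meshGraph Ω δ ≤ meshGraph Ω' δ := by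
  intro x y hxy
  rw [meshGraph_adj_iff] at hxy ⊢
  exact ⟨hxy.1, hxy.2.trans (closure_mono h)⟩

/-- Reachability in the mesh vertex graph is monotone in the domain. [folklore] -/
theorem reachable_meshVertexGraph_mono {Ω Ω' : Set ℂ} (h : Ω ⊆ Ω') {δ : ℝ}
    {x y : meshVertices Ω δ} (hxy : (meshVertexGraph Ω δ).Reachable x y) :
    (meshVertexGraph Ω' δ).Reachable
      (⟨x.1, meshVertices_mono h δ x.2⟩ : meshVertices Ω' δ) ⟨y.1, meshVertices_mono h δ y.2⟩ := by
  let φ : meshVertexGraph Ω δ →g meshVertexGraph Ω' δ :=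
    { toFun := fun v => ⟨v.1, meshVertices_mono h δ v.2⟩
      map_rel' := fun {a b} hab => by
        show (meshGraph Ω' δ).Adj a.1 b.1
        exact meshGraph_mono h δ hab }
  exact hxy.map φ

/-- **Eventual monotonicity of the largest-component discretisation (Jordan domains).**  If
`D.carrier ⊆ D'.carrier` then for all small meshes `δ > 0` the discrete domain of `D` lies in
that of `D'` and the graph `Ω_δ` is a subgraph of `Ω'_δ`. [folklore] -/
theorem _root_.Literature.Probability.RandomPlanarGeometry.JordanDomain.eventually_meshDomain_subset
    (D D' : JordanDomain) (h : D.carrier ⊆ D'.carrier) :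
    ∀ᶠ δ : ℝ in 𝓝[>] 0, meshDomain D.carrier δ ⊆ meshDomain D'.carrier δ ∧
      discreteDomainGraph D.carrier δ ≤ discreteDomainGraph D'.carrier δ := by
  -- a closed ball inside the smaller domain
  obtain ⟨z₀, hz₀⟩ := D.nonempty
  obtain ⟨ρ, hρ, hball⟩ := Metric.isOpen_iff.1 D.isOpen z₀ hz₀
  have hK : IsCompact (closedBall z₀ (ρ / 2)) := isCompact_closedBall _ _
  have hKΩ : closedBall z₀ (ρ / 2) ⊆ D.carrier :=
    (closedBall_subset_ball (by linarith)).trans hball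
  obtain ⟨δ₁, hδ₁, H₁⟩ := D.exists_forall_mem_meshDomain_and_reachable hK hKΩ
  obtain ⟨δ₂, hδ₂, H₂⟩ := D'.exists_forall_mem_meshDomain_and_reachable hK (hKΩ.trans h)
  have hm : 0 < min (min δ₁ δ₂) (ρ / 2) := lt_min (lt_min hδ₁ hδ₂) (by linarith)
  filter_upwards [Ioo_mem_nhdsGT hm] with δ hδ
  have hδ0 : 0 < δ := hδ.1
  have hδ1 : δ < δ₁ := hδ.2.trans_le ((min_le_left _ _).trans (min_le_left _ _))
  have hδ2 : δ < δ₂ := hδ.2.trans_le ((min_le_left _ _).trans (min_le_right _ _))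
  have hδρ : δ < ρ / 2 := hδ.2.trans_le (min_le_right _ _)
  -- a common site of both discrete domains
  set x₀ : Site 2 := nearestSite δ z₀ with hx₀
  have hx₀K : meshPoint δ x₀ ∈ closedBall z₀ (ρ / 2) := by
    rw [mem_closedBall]
    exact (dist_meshPoint_nearestSite_le hδ0 z₀).trans hδρ.le
  have hx₀D : x₀ ∈ meshDomain D.carrier δ := (H₁ δ hδ0 hδ1).1 x₀ hx₀K
  have hx₀D' : x₀ ∈ meshDomain D'.carrier δ := (H₂ δ hδ0 hδ2).1 x₀ hx₀K
  -- vertices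
  have hsub : meshDomain D.carrier δ ⊆ meshDomain D'.carrier δ := by
    intro x hx
    obtain ⟨hx₀v, hxv, hreach⟩ := (H₁ δ hδ0 hδ1).2 x₀ hx₀D x hx
    have hreach' := reachable_meshVertexGraph_mono h (x := ⟨x₀, hx₀v⟩) (y := ⟨x, hxv⟩) hreach
    exact mem_meshDomain_of_reachable_meshVertexGraph hx₀D' (meshVertices_mono h δ hx₀v)
      (meshVertices_mono h δ hxv) hreach'
  refine ⟨hsub, fun x y hxy => ?_⟩
  -- edges
  rw [discreteDomainGraph_adj_iff] at hxy ⊢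
  exact ⟨meshGraph_mono h δ hxy.1, hsub hxy.2.1, hsub hxy.2.2⟩

/-- The form consumed by STUB A: under `UpperCollarGeom R D G`, for all small meshes the free
crossing's graph `Ω_δ` (of the rectangle `R`) is a subgraph of the collared domain's `D_δ`, and
`Ω_δ ⊆ D_δ`. [folklore] -/
theorem UpperCollarGeom.eventually_discreteDomainGraph_le {R : ConformalRectangle}
    {D : DobrushinDomain} {G : Set ℂ} (hg : UpperCollarGeom R D G) :
    ∀ᶠ δ : ℝ in 𝓝[>] 0, meshDomain R.carrier δ ⊆ meshDomain D.carrier δ ∧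
      discreteDomainGraph R.carrier δ ≤ discreteDomainGraph D.carrier δ :=
  R.toJordanDomain.eventually_meshDomain_subset D.toJordanDomain hg.carrier_subset

/-- Consequence used verbatim in the fence argument: eventually, an edge of the open crossing
graph `openGraph ω ⊓ Ω_δ` of the rectangle is an edge of the collared discrete domain `D_δ`.
[folklore] -/
theorem UpperCollarGeom.eventually_edge_mem {R : ConformalRectangle}
    {D : DobrushinDomain} {G : Set ℂ} (hg : UpperCollarGeom R D G) :
    ∀ᶠ δ : ℝ in 𝓝[>] 0, ∀ (ω : Percolation.BondConfig (Site 2)) (x y : Site 2),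
      (Percolation.openGraph ω ⊓ discreteDomainGraph R.carrier δ).Adj x y →
        s(x, y) ∈ (discreteDomainGraph D.carrier δ).edgeSet ∧ s(x, y) ∈ ω := by
  filter_upwards [UpperCollarGeom.eventually_discreteDomainGraph_le hg] with δ hδ ω x y hxy
  refine ⟨?_, ?_⟩
  · rw [SimpleGraph.mem_edgeSet]
    exact hδ.2 hxy.2
  · exact ((Percolation.openGraph_adj ω x y).1 hxy.1).1

end DrefuteG6

end Summit.CriticalPhenomena.CardyFormulaZ2.Cruxes.SLESixFamiliesGiveCardy.CollarTouchSandwich
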